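import Literature.Topology.FourManifolds.SubsphereLevel
import HarnessLib

/-!
# The two discs of the sub-sphere: the dome disc and the disc `D_A` on the filled sphere

Topic `Literature/Topology/FourManifolds`; fact seat of Alexander's theorem
(`provefact-Literature.Topology.FourManifolds.SphereEmbedding.schoenflies_exists_ball`, Schultens
(2014), Thm. 3.2.5).  **Everything in this file is proved; no definitions, no named facts.**

With `W = subSphere F P E₁ s δ ε₀` the smoothed sphere `S₁` of the capped-ball step
(`SubsphereLevel.lean`) and the open set `V = {ρ² < 1 + s/2, -s² < x₂ < 2s}` (written out, no
definition), this file proves the set-theoretic facts behind the decomposition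
`W = (dome disc) ∪ D_A`, `D_A = W ∖ V`, used to parametrise `W` by the round sphere
(`SubsphereParam.lean`):

* §1 `CappedBallLid.mem_subSphere_inter_iff` — `W ∩ V` is the open dome disc
  `{a = 0, ρ² < 1 + s/2}`; the closed dome disc lies in `W` (`domeDisc_subset`);
* §2 `CappedBallLid.fillFun_eq_zero_of_mem_diff` — `D_A ⊆ {F₂ = 0}` (the filled sphere);
* §3 `CappedBallLid.exists_mem_nhds_fillFun_zero_subset` — **near `D_A` the filled sphere
  `{F₂ = 0}` lies in `W`** (the two surfaces agree there); `D_A` is closed, off the circle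
  `β_c = {a = 0, ρ² = 1 + s/2}` it is off the closure of `V` (`exists_mem_nhds_not_V`); the upper
  wall point `(1, 0, s)` is on the filled sphere and off `W` (`upperWallPoint`); the circle `β_c`
  lies in `D_A` and is where the dome disc meets `D_A` (`circle_subset`, `hsq_eq_of_dome_of_not_V`).

## References
* J. Schultens, *Introduction to 3-Manifolds*, GSM 151, AMS (2014), Thm. 3.2.5, PDF pp. 42–45.
* J. M. Lee, *Introduction to Smooth Manifolds*, 2nd ed., Springer GTM 218 (2013), Ch. 5.
-/

open scoped RealInnerProductSpace Topology Manifold ContDiff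
open Set Filter Metric Function

noncomputable section

namespace Literature.Topology.FourManifolds

namespace CappedBallLid

variable {F : EuclideanSpace ℝ (Fin 3) → ℝ} {P : ℝ → ℝ} {E₁ E₂ : Set (EuclideanSpace ℝ (Fin 3))}
  {w₀ η₀ ε₀ s δ : ℝ}

/-! ### §1 The dome disc: where the lid function is the top argument -/

/-- A zero of the lid function with `ρ² ≤ (1 + s/2)²` at height `≥ -2s` is on the dome/annulus
graph `a = 0` (there `r = s`, so `b ≤ -s - 3s²/4 < -κ`, and the smooth maximum is `a` unless it
is negative). [folklore] -/
theorem topFun_eq_zero_of_lidFun_eq_zero (hP : Admissible P) (hS : StepScale s δ w₀ η₀)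
    {x : EuclideanSpace ℝ (Fin 3)} (hx : lidFun P s x = 0) (h1 : hsq x ≤ (1 + s / 2) ^ 2)
    (h2 : -2 * s ≤ x 2) : topFun s x = 0 := by
  obtain ⟨hs, hs1, -, -, -, -⟩ := scales hS
  have hr : rimRadius s (x 2) = s := rimRadius_eq_self hs h2
  have hb : rimFun s x ≤ -s - 3 * s ^ 2 / 4 := by unfold rimFun; rw [hr]; nlinarith
  by_cases hcase : rimFun s x ≤ topFun s x - s / 8
  · rw [← lidFun_eq_topFun hP.hP0 hs hcase]; exact hx
  · exfalso
    push Not at hcase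
    have hle := lidFun_le_max_add hP.hPle hs x
    have hmax : max (topFun s x) (rimFun s x) < -s - 3 * s ^ 2 / 4 + s / 8 :=
      max_lt (by linarith) (by linarith)
    nlinarith

/-- **The part of the sub-sphere in the open set `V = {ρ² < 1 + s/2, -s² < x₂ < 2s}` is the open
dome disc** `{a = 0, ρ² < 1 + s/2}`. [folklore] -/
theorem mem_subSphere_inter_iff (hP : Admissible P) (hN : StepNF F E₁ E₂ w₀ η₀ ε₀)
    (hS : StepScale s δ w₀ η₀) (x : EuclideanSpace ℝ (Fin 3)) :
    (x ∈ subSphere F P E₁ s δ ε₀ ∧ hsq x < 1 + s / 2 ∧ -s ^ 2 < x 2 ∧ x 2 < 2 * s) ↔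
      (topFun s x = 0 ∧ hsq x < 1 + s / 2) := by
  obtain ⟨hs, hs1, hsw, hsη, hδ, hδs⟩ := scales hS
  have hsq2 : 1 + s / 2 ≤ (1 + s / 2) ^ 2 := by nlinarith
  constructor
  · rintro ⟨hW, h1, h2, h3⟩
    rw [subSphere_eq hP hN hS] at hW
    rcases hW with (⟨hG, hz⟩ | ⟨-, hz, -⟩) | ⟨-, hxB⟩
    · exact ⟨topFun_eq_zero_of_lidFun_eq_zero hP hS hG (by linarith) (by nlinarith), h1⟩
    · exfalso; nlinarith
    · exfalso; exact hxB ⟨by nlinarith, by nlinarith, by linarith⟩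
  · rintro ⟨ha, h1⟩
    have hG : lidFun P s x = 0 := lidFun_eq_zero_of_topFun_eq_zero hP.hP0 hs (by linarith) ha (by linarith)
    have hz : x 2 = s * (1 - hsq x) := by unfold topFun at ha; linarith
    have hz1 : -s ^ 2 < x 2 := by rw [hz]; nlinarith
    have hz2 : x 2 ≤ s := by rw [hz]; nlinarith [hsq_nonneg x]
    refine ⟨?_, h1, hz1, by linarith⟩
    rw [subSphere_eq hP hN hS]
    exact Or.inl (Or.inl ⟨hG, by nlinarith⟩)

/-- **The closed dome disc `{a = 0, ρ² ≤ 1 + s/2}` lies in the sub-sphere** (in its lid piece).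
[folklore] -/
theorem domeDisc_subset (hP : Admissible P) (hN : StepNF F E₁ E₂ w₀ η₀ ε₀)
    (hS : StepScale s δ w₀ η₀) {x : EuclideanSpace ℝ (Fin 3)} (ha : topFun s x = 0)
    (h1 : hsq x ≤ 1 + s / 2) : x ∈ subSphere F P E₁ s δ ε₀ := by
  obtain ⟨hs, hs1, -, -, -, -⟩ := scales hS
  have hG : lidFun P s x = 0 := lidFun_eq_zero_of_topFun_eq_zero hP.hP0 hs (by linarith) ha (by nlinarith)
  have hz : x 2 = s * (1 - hsq x) := by unfold topFun at ha; linarith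
  rw [subSphere_eq hP hN hS]
  exact Or.inl (Or.inl ⟨hG, by rw [hz]; nlinarith⟩)

/-- The height of a point of the dome graph: `x₂ = s(1 - ρ²)`. [folklore] -/
theorem coord_two_eq_of_topFun_eq_zero {x : EuclideanSpace ℝ (Fin 3)} (ha : topFun s x = 0) :
    x 2 = s * (1 - hsq x) := by unfold topFun at ha; linarith

/-! ### §2 The complementary disc `D_A = W ∖ V` lies on the boundary of the filled solid -/

/-- **`D_A = W ∖ V ⊆ {F₂ = 0}`**: off the open dome disc every point of the sub-sphere is a zero
of the filled defining function (on the lid piece outside `V`: `ρ² ≥ 1 + s/2`, where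
`F = ρ² - 1 ≥ s/2 ≥ G + δ` so `F₂ = G = 0`, or `x₂ ≤ -s²`, which forces the collar zone).
[folklore] -/
theorem fillFun_eq_zero_of_mem_diff (hP : Admissible P) (hN : StepNF F E₁ E₂ w₀ η₀ ε₀)
    (hS : StepScale s δ w₀ η₀) {x : EuclideanSpace ℝ (Fin 3)} (hW : x ∈ subSphere F P E₁ s δ ε₀)
    (hV : ¬ (hsq x < 1 + s / 2 ∧ -s ^ 2 < x 2 ∧ x 2 < 2 * s)) :
    fillFun F P s δ ((1 + s) ^ 2 + ε₀ + 2) x = 0 := by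
  obtain ⟨hs, hs1, hsw, hsη, hδ, hδs⟩ := scales hS
  rcases mem_lidPiece_or_fillFun_eq_zero hP hN hS hW with ⟨hG, hz⟩ | h
  swap; · exact h
  obtain ⟨hzs, hhsq⟩ := bounds_of_lidFun_eq_zero hP hS hG
  have hF : F x = hsq x - 1 := F_eq_of_box hN hS (by nlinarith) (abs_le.2 ⟨by linarith, by linarith⟩)
  have hw : fillWeight P s δ ((1 + s) ^ 2 + ε₀ + 2) x = 1 + lidFun P s x :=
    fillWeight_eq_of_mem_box hs (by nlinarith) hz (by linarith)
  simp only [not_and_or, not_lt] at hV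
  have case1 : 1 + s / 2 ≤ hsq x → fillFun F P s δ ((1 + s) ^ 2 + ε₀ + 2) x = 0 := by
    intro h1
    have : fillFun F P s δ ((1 + s) ^ 2 + ε₀ + 2) x =
        fillWeight P s δ ((1 + s) ^ 2 + ε₀ + 2) x - 1 :=
      fillFun_eq_right hP.hP1 hδ (by rw [hw, hF, hG]; linarith)
    rw [this, hw, hG]; ring
  rcases hV with h1 | h2 | h3
  · exact case1 h1
  · by_cases h1' : 1 + s / 2 ≤ hsq x
    · exact case1 h1'
    · push Not at h1'
      have hz2 : x 2 < -2 * s := by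
        by_contra hge
        push Not at hge
        have ha := topFun_eq_zero_of_lidFun_eq_zero hP hS hG (by nlinarith) hge
        have := coord_two_eq_of_topFun_eq_zero ha
        nlinarith
      have h18 := hsq_ge_of_lidFun_eq_zero hP hS hG hz2.le
      rw [fillFun_eq_lidFun_of_collar hP hN hS (by linarith) (by nlinarith) hz (by linarith)]
      exact hG
  · exfalso; linarith

/-! ### §3 Near `D_A` the boundary of the filled solid is the sub-sphere -/

/-- A zero of the filled function at height `≤ -2s` off `E₁` is in the sub-sphere (in the box:
the low piece, or the collar part of the lid piece; off the box: the far part of `E₂`).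
[folklore] -/
theorem mem_subSphere_of_fillFun_eq_zero_of_le (hP : Admissible P) (hN : StepNF F E₁ E₂ w₀ η₀ ε₀)
    (hS : StepScale s δ w₀ η₀) {y : EuclideanSpace ℝ (Fin 3)}
    (hy : fillFun F P s δ ((1 + s) ^ 2 + ε₀ + 2) y = 0) (hz : y 2 ≤ -2 * s) (hy1 : y ∉ E₁) :
    y ∈ subSphere F P E₁ s δ ε₀ := by
  obtain ⟨hs, hs1, hsw, hsη, hδ, hδs⟩ := scales hS
  rw [subSphere_eq hP hN hS]
  by_cases hyB : y ∈ closedBox s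
  · by_cases hz2 : y 2 ≤ -(5 * s / 2)
    · exact Or.inl (Or.inr ⟨hy, hz2, hyB⟩)
    · push Not at hz2
      obtain ⟨hin, hlat⟩ := collar_of_fillFun_eq_zero hP hN hS hy hyB (by linarith) hz
      have heq := fillFun_eq_lidFun_of_collar hP hN hS hin hlat (by linarith) hz
      exact Or.inl (Or.inl ⟨by rw [← heq]; exact hy, by linarith⟩)
  · have hF0 : F y = 0 := (fillFun_eq_zero_iff_of_not_mem hP hN hS hyB).1 hy
    have : y ∈ E₁ ∪ E₂ := by rw [← hN.hZ]; exact hF0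
    rcases this with h | h
    · exact absurd h hy1
    · exact Or.inr ⟨h, hyB⟩

/-- A zero of the filled function in the zone `{1 + s/4 < ρ² < (1+2s)², -4s < x₂ < 2s}` off `E₁`
is in the sub-sphere. [folklore] -/
theorem mem_subSphere_of_fillFun_eq_zero_of_annulus (hP : Admissible P)
    (hN : StepNF F E₁ E₂ w₀ η₀ ε₀) (hS : StepScale s δ w₀ η₀) {y : EuclideanSpace ℝ (Fin 3)}
    (hy : fillFun F P s δ ((1 + s) ^ 2 + ε₀ + 2) y = 0) (h1 : 1 + s / 4 < hsq y)
    (h2 : hsq y < (1 + 2 * s) ^ 2) (h3 : -4 * s < y 2) (h4 : y 2 < 2 * s) (hy1 : y ∉ E₁) :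
    y ∈ subSphere F P E₁ s δ ε₀ := by
  obtain ⟨hs, hs1, hsw, hsη, hδ, hδs⟩ := scales hS
  by_cases hz : y 2 ≤ -2 * s
  · exact mem_subSphere_of_fillFun_eq_zero_of_le hP hN hS hy hz hy1
  · push Not at hz
    -- `w - 1 = G`, `F = ρ² - 1 > s/4`, and `F₂ = 0` forces `G ∈ [0, δ]`, hence `F₂ = G = 0`
    have hw : fillWeight P s δ ((1 + s) ^ 2 + ε₀ + 2) y = 1 + lidFun P s y :=
      fillWeight_eq_of_mem_box hs h2.le (by linarith) h4.le
    have hF : F y = hsq y - 1 := F_eq_of_box hN hS (by nlinarith) (abs_le.2 ⟨by linarith, by linarith⟩)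
    have hle := fillFun_le_min hP.hPge hδ (F := F) (s := s) (M := (1 + s) ^ 2 + ε₀ + 2) y (P := P)
    have hmin := min_sub_le_fillFun hP.hPle hδ (F := F) (s := s) (M := (1 + s) ^ 2 + ε₀ + 2) y (P := P)
    rw [hy, hw] at hle hmin
    have hGle : lidFun P s y ≤ δ := by
      by_contra hgt; push Not at hgt
      have : δ < min (F y) (1 + lidFun P s y - 1) := lt_min (by rw [hF]; linarith) (by linarith)
      linarith
    have heq : fillFun F P s δ ((1 + s) ^ 2 + ε₀ + 2) y = fillWeight P s δ ((1 + s) ^ 2 + ε₀ + 2) y - 1 :=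
      fillFun_eq_right hP.hP1 hδ (by rw [hw, hF]; linarith)
    have hG : lidFun P s y = 0 := by rw [heq, hw] at hy; linarith
    rw [subSphere_eq hP hN hS]
    exact Or.inl (Or.inl ⟨hG, by linarith⟩)

/-- Points of `E₁` in the closed box are upper wall points. [folklore] -/
theorem wall_of_mem_left_closedBox (hN : StepNF F E₁ E₂ w₀ η₀ ε₀) (hS : StepScale s δ w₀ η₀)
    {x : EuclideanSpace ℝ (Fin 3)} (hx : x ∈ E₁) (hxB : x ∈ closedBox s) : hsq x = 1 ∧ 0 ≤ x 2 := by
  obtain ⟨hs, hs1, hsw, hsη, -, -⟩ := scales hS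
  obtain ⟨h1, h2, h3⟩ := hxB
  have hbox1 : hsq x ≤ (1 + 3 * w₀) ^ 2 := by nlinarith
  have hbox2 : |x 2| ≤ η₀ := abs_le.2 ⟨by linarith, by linarith⟩
  exact ⟨hN.hsq_eq_one (hN.eq_zero_of_mem_left hx) hbox1 hbox2, hN.hE₁box x hx hbox1 hbox2⟩

/-- **Near a point of `D_A = W ∖ V` every zero of the filled function is in the sub-sphere**
(there the boundary `{F₂ = 0}` of the filled solid and the sub-sphere coincide locally).
[folklore] -/
theorem exists_mem_nhds_fillFun_zero_subset (hP : Admissible P) (hN : StepNF F E₁ E₂ w₀ η₀ ε₀)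
    (hS : StepScale s δ w₀ η₀) {p : EuclideanSpace ℝ (Fin 3)} (hp : p ∈ subSphere F P E₁ s δ ε₀)
    (hpV : ¬ (hsq p < 1 + s / 2 ∧ -s ^ 2 < p 2 ∧ p 2 < 2 * s)) :
    ∃ N ∈ 𝓝 p, ∀ y ∈ N, fillFun F P s δ ((1 + s) ^ 2 + ε₀ + 2) y = 0 →
      y ∈ subSphere F P E₁ s δ ε₀ := by
  obtain ⟨hs, hs1, hsw, hsη, hδ, hδs⟩ := scales hS
  have hW := hp
  rw [subSphere_eq hP hN hS] at hp
  -- `p ∉ E₁` in all cases used below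
  have hpE₁ : p ∈ closedBox s → p 2 < 0 ∨ 1 < hsq p → p ∉ E₁ := by
    intro hpB h hp1
    obtain ⟨hw, hz⟩ := wall_of_mem_left_closedBox hN hS hp1 hpB
    rcases h with h | h
    · linarith
    · rw [hw] at h; linarith
  rcases hp with (⟨hG, hz⟩ | ⟨hF2, hz, hpB⟩) | ⟨hp2, hpB⟩
  · -- lid piece off `V`
    obtain ⟨hzs, hhsq⟩ := bounds_of_lidFun_eq_zero hP hS hG
    have hpB : p ∈ closedBox s := ⟨by nlinarith, by linarith, by linarith⟩
    simp only [not_and_or, not_lt] at hpV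
    rcases hpV with h1 | h2 | h3
    · -- `ρ² ≥ 1 + s/2`: the annulus zone
      have hp1 : p ∉ E₁ := hpE₁ hpB (Or.inr (by linarith))
      refine ⟨{y | 1 + s / 4 < hsq y ∧ hsq y < (1 + 2 * s) ^ 2 ∧ -4 * s < y 2 ∧ y 2 < 2 * s} ∩ E₁ᶜ,
        Filter.inter_mem ?_ (hN.hE₁.isOpen_compl.mem_nhds hp1), ?_⟩
      · refine IsOpen.mem_nhds ?_ ⟨by linarith, by nlinarith, by linarith, by linarith⟩
        exact (isOpen_lt continuous_const continuous_hsq).inter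
          ((isOpen_lt continuous_hsq continuous_const).inter
            ((isOpen_lt continuous_const (continuous_coord 2)).inter
              (isOpen_lt (continuous_coord 2) continuous_const)))
      · rintro y ⟨⟨hy1, hy2, hy3, hy4⟩, hyE⟩ hy
        exact mem_subSphere_of_fillFun_eq_zero_of_annulus hP hN hS hy hy1 hy2 hy3 hy4 hyE
    · -- `x₂ ≤ -s²` (and `ρ² < 1 + s/2`): then `x₂ < -2s`
      by_cases h1' : 1 + s / 2 ≤ hsq p
      · have hp1 : p ∉ E₁ := hpE₁ hpB (Or.inr (by linarith))
        refine ⟨{y | 1 + s / 4 < hsq y ∧ hsq y < (1 + 2 * s) ^ 2 ∧ -4 * s < y 2 ∧ y 2 < 2 * s} ∩ E₁ᶜ,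
          Filter.inter_mem ?_ (hN.hE₁.isOpen_compl.mem_nhds hp1), ?_⟩
        · refine IsOpen.mem_nhds ?_ ⟨by linarith, by nlinarith, by linarith, by linarith⟩
          exact (isOpen_lt continuous_const continuous_hsq).inter
            ((isOpen_lt continuous_hsq continuous_const).inter
              ((isOpen_lt continuous_const (continuous_coord 2)).inter
                (isOpen_lt (continuous_coord 2) continuous_const)))
        · rintro y ⟨⟨hy1, hy2, hy3, hy4⟩, hyE⟩ hy
          exact mem_subSphere_of_fillFun_eq_zero_of_annulus hP hN hS hy hy1 hy2 hy3 hy4 hyE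
      · push Not at h1'
        have hz2 : p 2 < -2 * s := by
          by_contra hge; push Not at hge
          have ha := topFun_eq_zero_of_lidFun_eq_zero hP hS hG (by nlinarith) hge
          have := coord_two_eq_of_topFun_eq_zero ha
          nlinarith
        have hp1 : p ∉ E₁ := hpE₁ hpB (Or.inl (by linarith))
        refine ⟨{y | y 2 < -2 * s} ∩ E₁ᶜ, Filter.inter_mem
          ((isOpen_lt (continuous_coord 2) continuous_const).mem_nhds hz2)
          (hN.hE₁.isOpen_compl.mem_nhds hp1), ?_⟩
        rintro y ⟨hy1, hyE⟩ hy
        exact mem_subSphere_of_fillFun_eq_zero_of_le hP hN hS hy (le_of_lt hy1) hyE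
    · exfalso; linarith
  · -- low piece
    have hp1 : p ∉ E₁ := hpE₁ hpB (Or.inl (by linarith))
    have hz2 : p 2 < -2 * s := by linarith
    refine ⟨{y | y 2 < -2 * s} ∩ E₁ᶜ, Filter.inter_mem
      ((isOpen_lt (continuous_coord 2) continuous_const).mem_nhds hz2)
      (hN.hE₁.isOpen_compl.mem_nhds hp1), ?_⟩
    rintro y ⟨hy1, hyE⟩ hy
    exact mem_subSphere_of_fillFun_eq_zero_of_le hP hN hS hy (le_of_lt hy1) hyE
  · -- far part of `E₂`
    have hp1 : p ∉ E₁ := by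
      intro h
      obtain ⟨hw, hz⟩ := hN.hE₁₂ ⟨h, hp2⟩
      exact hpB ⟨by rw [hw]; nlinarith, by rw [hz]; linarith, by rw [hz]; linarith⟩
    refine ⟨(closedBox s)ᶜ ∩ E₁ᶜ, Filter.inter_mem (isClosed_closedBox.isOpen_compl.mem_nhds hpB)
      (hN.hE₁.isOpen_compl.mem_nhds hp1), ?_⟩
    rintro y ⟨hyB, hyE⟩ hy
    have hF0 : F y = 0 := (fillFun_eq_zero_iff_of_not_mem hP hN hS hyB).1 hy
    have : y ∈ E₁ ∪ E₂ := by rw [← hN.hZ]; exact hF0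
    rcases this with h | h
    · exact absurd h hyE
    · rw [subSphere_eq hP hN hS]; exact Or.inr ⟨h, hyB⟩

/-- **A point of `D_A` off the circle `β_c = {a = 0, ρ² = 1 + s/2}` is not in the closure of
`V`**: it has a neighbourhood missing `V`. [folklore] -/
theorem exists_mem_nhds_not_V (hP : Admissible P) (hN : StepNF F E₁ E₂ w₀ η₀ ε₀)
    (hS : StepScale s δ w₀ η₀) {p : EuclideanSpace ℝ (Fin 3)} (hp : p ∈ subSphere F P E₁ s δ ε₀)
    (hpV : ¬ (hsq p < 1 + s / 2 ∧ -s ^ 2 < p 2 ∧ p 2 < 2 * s))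
    (hpc : ¬ (topFun s p = 0 ∧ hsq p = 1 + s / 2)) :
    ∃ N ∈ 𝓝 p, ∀ y ∈ N, ¬ (hsq y < 1 + s / 2 ∧ -s ^ 2 < y 2 ∧ y 2 < 2 * s) := by
  obtain ⟨hs, hs1, hsw, hsη, hδ, hδs⟩ := scales hS
  -- `p` is off the closed set `{ρ² ≤ 1 + s/2, -s² ≤ x₂ ≤ 2s} ⊇ closure V`
  have hnot : ¬ (hsq p ≤ 1 + s / 2 ∧ -s ^ 2 ≤ p 2 ∧ p 2 ≤ 2 * s) := by
    rintro ⟨h1, h2, h3⟩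
    simp only [not_and_or, not_lt] at hpV
    rw [subSphere_eq hP hN hS] at hp
    rcases hp with (⟨hG, hz⟩ | ⟨-, hz, -⟩) | ⟨-, hpB⟩
    · obtain ⟨hzs, -⟩ := bounds_of_lidFun_eq_zero hP hS hG
      -- in the lid piece: `x₂ ≥ -s² ≥ -2s` gives `a = 0`, so `ρ² = 1 - x₂/s`
      have ha := topFun_eq_zero_of_lidFun_eq_zero hP hS hG (by nlinarith) (by nlinarith)
      have hzeq := coord_two_eq_of_topFun_eq_zero ha
      rcases hpV with h | h | h
      · exact hpc ⟨ha, le_antisymm h1 h⟩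
      · -- `x₂ = -s²` would give `ρ² = 1 + s > 1 + s/2`
        nlinarith
      · linarith
    · nlinarith
    · exact hpB ⟨by nlinarith, by nlinarith, by linarith⟩
  refine ⟨{y | ¬ (hsq y ≤ 1 + s / 2 ∧ -s ^ 2 ≤ y 2 ∧ y 2 ≤ 2 * s)}, ?_, fun y hy h => hy ⟨h.1.le, h.2.1.le, h.2.2.le⟩⟩
  refine IsOpen.mem_nhds ?_ hnot
  have : IsClosed {y : EuclideanSpace ℝ (Fin 3) | hsq y ≤ 1 + s / 2 ∧ -s ^ 2 ≤ y 2 ∧ y 2 ≤ 2 * s} :=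
    (isClosed_le continuous_hsq continuous_const).inter
      ((isClosed_le continuous_const (continuous_coord 2)).inter
        (isClosed_le (continuous_coord 2) continuous_const))
  exact this.isOpen_compl

/-- `D_A = W ∖ V` is closed. [folklore] -/
theorem isClosed_subSphere_diff (hP : Admissible P) (hN : StepNF F E₁ E₂ w₀ η₀ ε₀)
    (hS : StepScale s δ w₀ η₀) :
    IsClosed (subSphere F P E₁ s δ ε₀ ∩
      {x | ¬ (hsq x < 1 + s / 2 ∧ -s ^ 2 < x 2 ∧ x 2 < 2 * s)}) := by
  refine (isCompact_subSphere hP hN hS).isClosed.inter ?_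
  have : IsOpen {x : EuclideanSpace ℝ (Fin 3) | hsq x < 1 + s / 2 ∧ -s ^ 2 < x 2 ∧ x 2 < 2 * s} :=
    (isOpen_lt continuous_hsq continuous_const).inter
      ((isOpen_lt continuous_const (continuous_coord 2)).inter
        (isOpen_lt (continuous_coord 2) continuous_const))
  exact this.isClosed_compl

/-- **The boundary of the filled solid is larger than the sub-sphere's disc `D_A`**: the upper
wall point `(1, 0, s)` is a zero of the filled function, off the sub-sphere, off `V`. [folklore] -/
theorem upperWallPoint (hP : Admissible P) (hN : StepNF F E₁ E₂ w₀ η₀ ε₀) (hS : StepScale s δ w₀ η₀) :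
    fillFun F P s δ ((1 + s) ^ 2 + ε₀ + 2)
        (EuclideanSpace.single (0 : Fin 3) (1 : ℝ) + s • EuclideanSpace.single (2 : Fin 3) (1 : ℝ)) = 0 ∧
      (EuclideanSpace.single (0 : Fin 3) (1 : ℝ) + s • EuclideanSpace.single (2 : Fin 3) (1 : ℝ)) ∉
        subSphere F P E₁ s δ ε₀ := by
  obtain ⟨hs, hs1, hsw, hsη, hδ, hδs⟩ := scales hS
  set u : EuclideanSpace ℝ (Fin 3) := EuclideanSpace.single (0 : Fin 3) (1 : ℝ) +
    s • EuclideanSpace.single (2 : Fin 3) (1 : ℝ) with hu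
  have hu0 : u 0 = 1 := by simp [hu]
  have hu1 : u 1 = 0 := by simp [hu]
  have hu2 : u 2 = s := by simp [hu]
  have hh : hsq u = 1 := by simp [hsq, hu0, hu1]
  have hF : F u = 0 := by
    rw [F_eq_of_box hN hS (by rw [hh]; nlinarith) (by rw [hu2, abs_of_pos hs]; linarith), hh]; ring
  have ha : topFun s u = s := by unfold topFun; rw [hu2, hh]; ring
  have hG : s ≤ lidFun P s u := by
    have := max_le_lidFun hP.hPge hs u
    rw [ha] at this
    exact (le_max_left _ _).trans this
  have hw : fillWeight P s δ ((1 + s) ^ 2 + ε₀ + 2) u = 1 + lidFun P s u :=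
    fillWeight_eq_of_mem_box hs (by rw [hh]; nlinarith) (by rw [hu2]; linarith) (by rw [hu2]; linarith)
  constructor
  · rw [fillFun_eq_left hP.hP0 hδ (by rw [hw, hF]; linarith)]; exact hF
  · intro hW
    rw [subSphere_eq hP hN hS] at hW
    rcases hW with (⟨hG0, -⟩ | ⟨-, hz, -⟩) | ⟨-, huB⟩
    · linarith
    · rw [hu2] at hz; linarith
    · exact huB ⟨by rw [hh]; nlinarith, by rw [hu2]; linarith, by rw [hu2]; linarith⟩

/-- The upper wall point is not on the circle `β_c`. [folklore] -/
theorem upperWallPoint_not_circle (hS : StepScale s δ w₀ η₀) :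
    ¬ (topFun s (EuclideanSpace.single (0 : Fin 3) (1 : ℝ) + s • EuclideanSpace.single (2 : Fin 3) (1 : ℝ)) = 0 ∧
      hsq (EuclideanSpace.single (0 : Fin 3) (1 : ℝ) + s • EuclideanSpace.single (2 : Fin 3) (1 : ℝ)) = 1 + s / 2) := by
  rintro ⟨-, hh⟩
  have : hsq (EuclideanSpace.single (0 : Fin 3) (1 : ℝ) + s • EuclideanSpace.single (2 : Fin 3) (1 : ℝ)) = 1 := by
    simp [hsq]
  rw [this] at hh
  linarith [hS.hs]

/-- **The circle `β_c = {a = 0, ρ² = 1 + s/2}` lies in `D_A`** (in the sub-sphere, off `V`), and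
**the dome disc meets `D_A` exactly along it**. [folklore] -/
theorem circle_subset (hP : Admissible P) (hN : StepNF F E₁ E₂ w₀ η₀ ε₀) (hS : StepScale s δ w₀ η₀)
    {x : EuclideanSpace ℝ (Fin 3)} (ha : topFun s x = 0) (hh : hsq x = 1 + s / 2) :
    x ∈ subSphere F P E₁ s δ ε₀ ∧ ¬ (hsq x < 1 + s / 2 ∧ -s ^ 2 < x 2 ∧ x 2 < 2 * s) :=
  ⟨domeDisc_subset hP hN hS ha hh.le, fun h => by linarith [h.1]⟩

/-- A point of the dome disc in `D_A` is on the circle. [folklore] -/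
theorem hsq_eq_of_dome_of_not_V (hS : StepScale s δ w₀ η₀) {x : EuclideanSpace ℝ (Fin 3)}
    (ha : topFun s x = 0) (h1 : hsq x ≤ 1 + s / 2)
    (hV : ¬ (hsq x < 1 + s / 2 ∧ -s ^ 2 < x 2 ∧ x 2 < 2 * s)) : hsq x = 1 + s / 2 := by
  obtain ⟨hs, hs1, -, -, -, -⟩ := scales hS
  have hz := coord_two_eq_of_topFun_eq_zero ha
  simp only [not_and_or, not_lt] at hV
  rcases hV with h | h | h
  · linarith
  · nlinarith [hsq_nonneg x]
  · nlinarith [hsq_nonneg x]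

end CappedBallLid

end Literature.Topology.FourManifolds

end
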